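import Summits.ABC.IUTFork.Thm311RealIsmDHShallowMover
import HarnessLib

/-!
# [IUTchIII] Cor. 3.12 support — (Ind2) movers on `𝒪_v`-BOXES at a tame place: content classes, the mover to the
# top of the class, and the TWO-SIDED one-factor hull criterion (sequel to `Thm311RealIsmDHShallowMover`)

PROOF-ONLY file (0 definitions, 0 named `Prop` facts) of the abc-iut cell (WAVE-5 prover seat abc-iut-w5-d060, gen 6;
support piece «LICENCE-SHALLOW-LOCAL», part 2). TAKES NO SIDE on [IUTchIII] Cor. 3.12.

WHY A SEQUEL.  `Thm311RealIsmDHShallowMover` (p436390) moves SUB-BALLS `t·I_v` of the log-shell `I_v = p⁻¹·𝔪_v` to the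
top of `I_v`. But the cell's SHARP Θ-boxes are `ι_j(t_Θ)·(R_I)^∼` with `(R_I)^∼` the NORMALISATION of `R_I = ⊗ 𝒪_{v_a}`
(campaign-S `normalizedPacket`; Dupuy–Hilado §3.9), whose one-factor shadow is the ball **`t_Θ·𝒪_v = {‖y‖ ≤ ‖t_Θ‖}`** —
at a ramified place (`e ≥ 2`, `I_v = 𝔪_v^{1−e} ⊋ 𝒪_v`) NOT a sub-ball `t·I_v` with `‖t‖ > p⁻¹` unless `t_Θ` is a
unit. For `ord_v(t_Θ) ≥ 1` the box lies in the lattice `Λ := log_p(𝒪_v^×) = 𝔪_v` itself (tame evaluation, [IUTchIV]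
Prop. 1.2 (i)), and the right bookkeeping is by CONTENT w.r.t. `Λ`: `t` has content `m ∈ ℤ` when
`t ∈ p^m·Λ ∖ p^{m+1}·Λ`, i.e. `p⁻¹·‖ϖ‖ < p^m·‖t‖ ≤ ‖ϖ‖`, i.e. `e·m + 1 ≤ ord_v(t) ≤ e·(m+1)`. This corrects the
window of the hand argument on HOME/STATUS (abc-iut-c312-3 2026-08-26T08:51:10Z wrote the Θ-box as containing
`ι_j(t_Θ)·⊗_a I_{v_a}`; with `(R_I)^∼` = normalisation the one-factor window is `1 ≤ ord_v(t_Θ) ≤ e(v|p)`, which for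
realising ideles `t_Θ = t_q^{j²}` is the same numerical window «`j²·ord_v(t_q) ≤ e_v`») and matches abc-iut-w4-d094's
regime (B) (08:41:43Z: «a_v ≥ e_v·⌊(j²a_v − 1)/e_v⌋ + 1», hand computation) — now KERNEL at one factor, and TWO-SIDED.

RESULTS (`v | p`, `p > 2`, `e := e(v|p) ≤ p − 2`, any `f`; `LogvAnalyticAt p logv`; `ϖ` a norm uniformizer of abc-iut-S7's
`RescaledCompletion F p v hv`; (Ind2) slot = abc-iut-c312-5's `Real.ismDH logv (inr v)`, Dupuy–Hilado §4.9):
* `mem_basisLattice_and_exists_repr_eq_one_of_tame` — vectors with `p⁻¹‖ϖ‖ < ‖y‖ ≤ ‖ϖ‖` are PRIMITIVE in `Λ = 𝔪_v`;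
* `exists_latticeAut_ismDH_map_eq_of_tame` — for primitive `x`: a lattice automorphism `φ` with `φ x = ϖ`, realised by
  some `g ∈ Real.ismDH` (w5-d180's dictionary), fixing every ball `c·Λ`, `c ∈ ℚ_p`;
* **`exists_mem_ismDH_map_eq_zpow_smul_of_tame`** — MOVER TO THE TOP OF THE CONTENT CLASS: for `t` of content `m` some
  `g ∈ Real.ismDH` has `g(t) = p^m·ϖ`, `g '' (t·𝒪_v) ⊆ p^m·𝔪_v = {‖y‖ ≤ p^{−m}‖ϖ‖} ∋ p^m·ϖ`, so every ball
  `μ·𝒪_v ⊇ g '' (t·𝒪_v)` contains `p^m·𝔪_v`;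
* **`exists_mem_ismDH_image_closedBall_of_shallow`** — THE ONE-FACTOR SHALLOW LICENCE (`m = 0`, i.e.
  `1 ≤ ord_v(t_Θ) ≤ e`): `g(t_Θ) = ϖ`, and every one-factor hull-set `μ·𝒪_v` ([IUTchIII] Rmk. 3.9.5 (i)) containing
  `g '' (t_Θ·𝒪_v)` contains `𝔪_v ⊇ t_q·𝒪_v` for EVERY non-unit integer `t_q`;
* **`forall_ismDH_image_closedBall_subset_of_tame`** — CONVERSE: every `g ∈ Real.ismDH` keeps a box of content `≥ m`
  inside `p^m·𝔪_v`; so the one-factor hull of the whole (Ind2)-orbit of a content-`m` box is EXACTLY `p^m·𝔪_v`, and at one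
  factor «the q-box lies in the hull of some (Ind2)-image of the Θ-box» iff `ord_v(t_q) ≥ e·m + 1`.

USE / NOT DONE HERE: the `(j+1)`-fold tensor transport to the Summits-side frames of `Real.settingDHVolSharp` /
`settingPrVolSharp` (pure tensors `⊗_a g_{v_a}(μ_a)` of class-top elements inside `(⊗ g_{v_a})(ι_j(t_Θ)·(R_I)^∼)`, and
the hull-sets of `HullFrame.ofComparison`) is the consumer's (route (A) / abc-iut-c312-5's frame gap). HONEST FRAMING:
statements about OUR typed (Ind2) slot acting on one-factor balls; nothing about Cor. 3.12 or about which reading of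
[IUTchIII] Thm. 3.11 (i) (Ind2) is print's. [cite: DupuyHilado2025, §3.9, §4.9] [cite: WeilBNT1967, Ch. II §2, Th. 1–2]
[cite: NeukirchANT1999, Ch. II Prop. (5.5)] [claim: Mochizuki2012, status: disputed] for every [IUTchIII] locution.
Consumed BY NAME, nothing restated: `Real.ismDH`, `toR`/`ofR`, `LogvAnalyticAt` (c312-5), `RescaledCompletion` (S7),
`PadicModule.basisLattice`/`primitive_iff_not_mem_p_smul`/`exists_latticeAut_map_eq`/`image_smul_basisLattice_of_mem`
(campaign S), `exists_basis_coe_logUnits_eq`, `logUnits_eq_closedBall_of_tame`, `exists_mem_ismDH_of_mem_latticeAut`,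
`exists_mem_latticeAut_of_mem_ismDH` (w5-d180). typed ≠ proved; no side taken on [IUTchIII] Cor. 3.12.
-/

noncomputable section

open Set Metric NumberField IsDedekindDomain
open scoped Pointwise

namespace Summit.ABC.IUTFork.Thm311.Real

open Cor312Vol Literature.IUT.LogThetaLattice Literature.IUT.LogVolume Literature.NumberTheory.NumberFields
open Literature.NumberTheory.GaloisRepresentations.Ultrametric

variable {F : Type} [Field F] [NumberField F] {p : ℕ} [hp : Fact p.Prime]
variable {logv : PadicLogs F} (hlog : LogvAnalyticAt p logv)
variable {v : HeightOneSpectrum (𝓞 F)} {hv : ((p : ℕ) : 𝓞 F) ∈ v.asIdeal}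

/-! ## 1. `𝒪_v`-boxes: content classes, the mover to the top of the class, the one-factor hull criterion

The SHARP Θ-boxes of the cell are `ι_j(t_Θ)·(R_I)^∼` with `(R_I)^∼` the NORMALISATION (campaign-S `normalizedPacket`),
whose one-factor shadow is the ball `t_Θ·𝒪_v = {‖y‖ ≤ ‖t_Θ‖}` — inside `Λ = log_p(𝒪_v^×) = 𝔪_v` as soon as
`ord_v(t_Θ) ≥ 1`, and NOT the sub-ball `t_Θ·I_v` of §2–3 (at `e ≥ 2`, `I_v = 𝔪_v^{1−e} ⊄ 𝒪_v`). For these the lattice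
`Λ` itself (not `I_v = p⁻¹Λ`) is the frame of reference: a vector `t` has CONTENT `m` when `t ∈ p^m·Λ ∖ p^{m+1}·Λ`,
i.e. `p⁻¹‖ϖ‖ < p^m·‖t‖ ≤ ‖ϖ‖`; `Aut_{ℚ_p}(K_v : Λ)` moves `t` exactly onto the vectors of content `m`, whose member of
largest norm is `p^m·ϖ`. -/

/-- **Primitive vectors of `Λ = log_p(𝒪_v^×) = 𝔪_v` at a tame place, by norm**: if `log_p(𝒪_v^×)` is the lattice of
the basis `B` (w5-d180 `exists_basis_coe_logUnits_eq`) then every `y` with `p⁻¹·‖ϖ‖ < ‖y‖ ≤ ‖ϖ‖` lies in it and has a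
unit coordinate (`y ∉ p·Λ = {‖·‖ ≤ p⁻¹‖ϖ‖}`; campaign-S `PadicModule.primitive_iff_not_mem_p_smul`).
[cite: WeilBNT1967, Ch. II §2, Th. 2] [cite: NeukirchANT1999, Ch. II Prop. (5.5)] -/
theorem mem_basisLattice_and_exists_repr_eq_one_of_tame (hp2 : 2 < p) (he : v.asIdeal.ramificationIdx ℤ ≤ p - 2)
    {ϖ : (RescaledCompletion F p v hv)ˣ} (hϖ : IsUniformizer ϖ) {n : ℕ}
    (B : Module.Basis (Fin n) ℚ_[p] (RescaledCompletion F p v hv))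
    (hΛ : (logUnits (RescaledCompletion F p v hv) : Set (RescaledCompletion F p v hv)) =
      (PadicModule.basisLattice p B : Set (RescaledCompletion F p v hv)))
    {y : RescaledCompletion F p v hv} (h1 : (p : ℝ)⁻¹ * ‖(ϖ : RescaledCompletion F p v hv)‖ < ‖y‖)
    (h2 : ‖y‖ ≤ ‖(ϖ : RescaledCompletion F p v hv)‖) :
    y ∈ PadicModule.basisLattice p B ∧ ∃ i, ‖B.repr y i‖ = 1 := by
  have hball : (PadicModule.basisLattice p B : Set (RescaledCompletion F p v hv)) =
      closedBall 0 ‖(ϖ : RescaledCompletion F p v hv)‖ := by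
    rw [← hΛ, logUnits_eq_closedBall_of_tame hp2 he hϖ]
  have hmemΛ : ∀ z : RescaledCompletion F p v hv,
      z ∈ PadicModule.basisLattice p B ↔ ‖z‖ ≤ ‖(ϖ : RescaledCompletion F p v hv)‖ := fun z => by
    rw [← SetLike.mem_coe, hball, mem_closedBall_zero_iff]
  have hy : y ∈ PadicModule.basisLattice p B := (hmemΛ y).2 h2
  refine ⟨hy, (PadicModule.primitive_iff_not_mem_p_smul p B hy).2 ?_⟩
  rintro ⟨z, hz, rfl⟩
  have hz' : ‖z‖ ≤ ‖(ϖ : RescaledCompletion F p v hv)‖ := (hmemΛ z).1 hz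
  have hle : ‖(p : ℚ_[p]) • z‖ ≤ (p : ℝ)⁻¹ * ‖(ϖ : RescaledCompletion F p v hv)‖ := by
    rw [norm_smul, Padic.norm_p]
    exact mul_le_mul_of_nonneg_left hz' (by positivity)
  exact (not_lt.2 hle) h1

include hlog in
/-- **Dictionary form of the transitivity**: for a primitive `x` of `Λ = 𝔪_v` (`p⁻¹‖ϖ‖ < ‖x‖ ≤ ‖ϖ‖`) there are a
lattice automorphism `φ ∈ Aut_{ℚ_p}(K_v : Λ)` with `φ x = ϖ` and an (Ind2)-element `g ∈ Real.ismDH logv (inr v)` acting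
as `φ`; `φ` maps every ball `{‖y‖ ≤ ‖c‖·‖ϖ‖} = c·Λ`, `c ∈ ℚ_p`, onto itself. [cite: DupuyHilado2025, §4.9]
[cite: WeilBNT1967, Ch. II §2, Th. 1] [claim: Mochizuki2012, status: disputed] -/
theorem exists_latticeAut_ismDH_map_eq_of_tame (hp2 : 2 < p) (he : v.asIdeal.ramificationIdx ℤ ≤ p - 2)
    {ϖ : (RescaledCompletion F p v hv)ˣ} (hϖ : IsUniformizer ϖ) {x : RescaledCompletion F p v hv}
    (hx1 : (p : ℝ)⁻¹ * ‖(ϖ : RescaledCompletion F p v hv)‖ < ‖x‖) (hx2 : ‖x‖ ≤ ‖(ϖ : RescaledCompletion F p v hv)‖) :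
    ∃ φ : RescaledCompletion F p v hv ≃ₗ[ℚ_[p]] RescaledCompletion F p v hv, ∃ g ∈ ismDH logv (.inr v),
      (∀ a, toR p v hv (g (ofR p v hv a)) = φ a) ∧ φ x = ϖ ∧
      ∀ (c : ℚ_[p]) (y : RescaledCompletion F p v hv),
        ‖φ y‖ ≤ ‖c‖ * ‖(ϖ : RescaledCompletion F p v hv)‖ ↔ ‖y‖ ≤ ‖c‖ * ‖(ϖ : RescaledCompletion F p v hv)‖ := by
  obtain ⟨n, hn, B, hΛ⟩ := exists_basis_coe_logUnits_eq (p := p) v hv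
  have hball : (PadicModule.basisLattice p B : Set (RescaledCompletion F p v hv)) =
      closedBall 0 ‖(ϖ : RescaledCompletion F p v hv)‖ := by
    rw [← hΛ, logUnits_eq_closedBall_of_tame hp2 he hϖ]
  have hϖpos : 0 < ‖(ϖ : RescaledCompletion F p v hv)‖ := norm_pos_iff.2 ϖ.ne_zero
  obtain ⟨hxΛ, i, hi⟩ := mem_basisLattice_and_exists_repr_eq_one_of_tame hp2 he hϖ B hΛ hx1 hx2
  obtain ⟨hϖΛ, j, hj⟩ := mem_basisLattice_and_exists_repr_eq_one_of_tame hp2 he hϖ B hΛ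
    (mul_lt_of_lt_one_left hϖpos (inv_lt_one_of_one_lt₀ (by exact_mod_cast hp.out.one_lt))) le_rfl
  obtain ⟨φ, hφ, hφx⟩ := PadicModule.exists_latticeAut_map_eq p B hxΛ hϖΛ hi hj
  obtain ⟨g, hg, hgφ⟩ := exists_mem_ismDH_of_mem_latticeAut hlog B hΛ hφ
  refine ⟨φ, g, hg, hgφ, hφx, fun c y => ?_⟩
  by_cases hc : c = 0
  · subst hc
    rw [norm_zero, zero_mul, norm_le_zero_iff, norm_le_zero_iff, LinearEquiv.map_eq_zero_iff]
  · have himg := PadicModule.image_smul_basisLattice_of_mem p B hφ c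
    rw [hball, smul_closedBall _ _ (norm_nonneg _), smul_zero] at himg
    constructor
    · intro h
      have h' : φ y ∈ (φ : RescaledCompletion F p v hv → RescaledCompletion F p v hv) ''
          closedBall (0 : RescaledCompletion F p v hv) (‖c‖ * ‖(ϖ : RescaledCompletion F p v hv)‖) := by
        rw [himg]; exact mem_closedBall_zero_iff.2 h
      obtain ⟨y', hy', he'⟩ := h'
      rw [← φ.injective he']
      exact mem_closedBall_zero_iff.1 hy'
    · intro h
      have h' : φ y ∈ (φ : RescaledCompletion F p v hv → RescaledCompletion F p v hv) ''
          closedBall (0 : RescaledCompletion F p v hv) (‖c‖ * ‖(ϖ : RescaledCompletion F p v hv)‖) :=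
        ⟨y, mem_closedBall_zero_iff.2 h, rfl⟩
      rw [himg] at h'
      exact mem_closedBall_zero_iff.1 h'

omit hp in
/-- `‖p^m‖ = p^{−m}` in `ℚ_p`, written `((p : ℝ) ^ m)⁻¹`. [folklore] -/
theorem norm_padic_zpow_eq [Fact p.Prime] (m : ℤ) : ‖((p : ℚ_[p]) ^ m)‖ = ((p : ℝ) ^ m)⁻¹ := by
  rw [norm_zpow, Padic.norm_p, inv_zpow]

include hlog in
/-- **MOVER TO THE TOP OF THE CONTENT CLASS.** At `v | p`, `p > 2`, `e(v|p) ≤ p − 2`, analytic logarithm: for `t` of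
content `m` w.r.t. `Λ = log_p(𝒪_v^×) = 𝔪_v` — `p⁻¹·‖ϖ‖ < p^m·‖t‖ ≤ ‖ϖ‖`, i.e. `e·m + 1 ≤ ord_v(t) ≤ e·(m+1)` — there is
`g ∈ Real.ismDH logv (inr v)` with (i) **`g(t) = p^m·ϖ`**, (ii) `g '' (t·𝒪_v) ⊆ p^m·𝔪_v = {‖y‖ ≤ p^{−m}·‖ϖ‖}`,
(iii) `p^m·ϖ ∈ g '' (t·𝒪_v)` of norm (iv) `p^{−m}·‖ϖ‖`, so (v) every ball `μ·𝒪_v ⊇ g '' (t·𝒪_v)` contains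
`p^m·𝔪_v`: the one-factor holomorphic hull of the moved box `t·𝒪_v` is `p^m·𝔪_v`. (`x := p^{−m}·t` is primitive;
`exists_latticeAut_ismDH_map_eq_of_tame`; `ℚ_p`-linearity of `φ`.) [cite: DupuyHilado2025, §4.9]
[cite: WeilBNT1967, Ch. II §2, Th. 1–2] [claim: Mochizuki2012, status: disputed] -/
theorem exists_mem_ismDH_map_eq_zpow_smul_of_tame (hp2 : 2 < p) (he : v.asIdeal.ramificationIdx ℤ ≤ p - 2)
    {ϖ : (RescaledCompletion F p v hv)ˣ} (hϖ : IsUniformizer ϖ) {t : RescaledCompletion F p v hv} (m : ℤ)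
    (ht1 : (p : ℝ)⁻¹ * ‖(ϖ : RescaledCompletion F p v hv)‖ < (p : ℝ) ^ m * ‖t‖)
    (ht2 : (p : ℝ) ^ m * ‖t‖ ≤ ‖(ϖ : RescaledCompletion F p v hv)‖) :
    ∃ g ∈ ismDH logv (.inr v),
      toR p v hv (g (ofR p v hv t)) = ((p : ℚ_[p]) ^ m) • (ϖ : RescaledCompletion F p v hv) ∧
      (fun a => toR p v hv (g (ofR p v hv a))) '' closedBall (0 : RescaledCompletion F p v hv) ‖t‖ ⊆
          closedBall 0 (((p : ℝ) ^ m)⁻¹ * ‖(ϖ : RescaledCompletion F p v hv)‖) ∧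
      ((p : ℚ_[p]) ^ m) • (ϖ : RescaledCompletion F p v hv) ∈
          (fun a => toR p v hv (g (ofR p v hv a))) '' closedBall (0 : RescaledCompletion F p v hv) ‖t‖ ∧
      ‖((p : ℚ_[p]) ^ m) • (ϖ : RescaledCompletion F p v hv)‖ =
          ((p : ℝ) ^ m)⁻¹ * ‖(ϖ : RescaledCompletion F p v hv)‖ ∧
      ∀ μ : RescaledCompletion F p v hv,
        (fun a => toR p v hv (g (ofR p v hv a))) '' closedBall (0 : RescaledCompletion F p v hv) ‖t‖ ⊆
            closedBall 0 ‖μ‖ →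
          closedBall (0 : RescaledCompletion F p v hv) (((p : ℝ) ^ m)⁻¹ * ‖(ϖ : RescaledCompletion F p v hv)‖) ⊆
            closedBall 0 ‖μ‖ := by
  set c : ℚ_[p] := (p : ℚ_[p]) ^ m with hc
  have hp0 : (p : ℚ_[p]) ≠ 0 := Nat.cast_ne_zero.mpr hp.out.ne_zero
  have hc0 : c ≠ 0 := zpow_ne_zero m hp0
  have hcn : ‖c‖ = ((p : ℝ) ^ m)⁻¹ := norm_padic_zpow_eq m
  have hpm : (0 : ℝ) < (p : ℝ) ^ m := zpow_pos (by exact_mod_cast hp.out.pos) m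
  -- `x := c⁻¹ • t` is primitive: `‖x‖ = p^m·‖t‖`
  set x : RescaledCompletion F p v hv := c⁻¹ • t with hx
  have hnx : ‖x‖ = (p : ℝ) ^ m * ‖t‖ := by rw [hx, norm_smul, norm_inv, hcn, inv_inv]
  obtain ⟨φ, g, hg, hgφ, hφx, hφball⟩ :=
    exists_latticeAut_ismDH_map_eq_of_tame hlog hp2 he hϖ (x := x) (by rw [hnx]; exact ht1) (by rw [hnx]; exact ht2)
  have htx : t = c • x := by rw [hx, smul_inv_smul₀ hc0]
  have hgt : toR p v hv (g (ofR p v hv t)) = c • (ϖ : RescaledCompletion F p v hv) := by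
    rw [hgφ, htx, LinearEquiv.map_smul, hφx]
  have hnorm : ‖c • (ϖ : RescaledCompletion F p v hv)‖ =
      ((p : ℝ) ^ m)⁻¹ * ‖(ϖ : RescaledCompletion F p v hv)‖ := by
    rw [norm_smul, hcn]
  -- `‖t‖ ≤ ‖c‖·‖ϖ‖`
  have htc : ‖t‖ ≤ ‖c‖ * ‖(ϖ : RescaledCompletion F p v hv)‖ := by
    rw [hcn, le_inv_mul_iff₀ hpm]; exact ht2
  have htop : c • (ϖ : RescaledCompletion F p v hv) ∈
      (fun a => toR p v hv (g (ofR p v hv a))) '' closedBall (0 : RescaledCompletion F p v hv) ‖t‖ :=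
    ⟨t, mem_closedBall_zero_iff.2 le_rfl, hgt⟩
  refine ⟨g, hg, hgt, ?_, htop, hnorm, fun μ hμ => ?_⟩
  · rintro _ ⟨a, ha, rfl⟩
    rw [mem_closedBall_zero_iff] at ha ⊢
    show ‖toR p v hv (g (ofR p v hv a))‖ ≤ _
    rw [hgφ, ← hcn]
    exact (hφball c a).2 (ha.trans htc)
  · have h := mem_closedBall_zero_iff.1 (hμ htop)
    rw [hnorm] at h
    exact closedBall_subset_closedBall h

include hlog in
/-- **THE ONE-FACTOR SHALLOW LICENCE** (content `0`). At `v | p`, `p > 2`, `e(v|p) ≤ p − 2`, analytic logarithm: for a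
Θ-value `t_Θ` with **`p⁻¹·‖ϖ‖ < ‖t_Θ‖ ≤ ‖ϖ‖`, i.e. `1 ≤ ord_v(t_Θ) ≤ e(v|p)`**, some `g ∈ Real.ismDH logv (inr v)`
has `g(t_Θ) = ϖ`, maps the Θ-box `t_Θ·𝒪_v = {‖y‖ ≤ ‖t_Θ‖}` into `𝔪_v` onto a set containing `ϖ`, and therefore EVERY
one-factor hull-set `μ·𝒪_v = {‖y‖ ≤ ‖μ‖}` ([IUTchIII] Rmk. 3.9.5 (i)) containing `g '' (t_Θ·𝒪_v)` contains
`𝔪_v = ϖ·𝒪_v` — hence contains the q-box `t_q·𝒪_v` of EVERY non-unit integer `t_q` (`‖t_q‖ ≤ ‖ϖ‖`), with no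
further relation between `t_q` and `t_Θ`. (abc-iut-c312-3's window «`j²·ord(t_q) ≤ e_v`» for `t_Θ = t_q^{j²}`;
abc-iut-w4-d094's regime (B) with `m = 0`.) [cite: DupuyHilado2025, §4.9] [cite: WeilBNT1967, Ch. II §2, Th. 1]
[claim: Mochizuki2012, status: disputed] -/
theorem exists_mem_ismDH_image_closedBall_of_shallow (hp2 : 2 < p) (he : v.asIdeal.ramificationIdx ℤ ≤ p - 2)
    {ϖ : (RescaledCompletion F p v hv)ˣ} (hϖ : IsUniformizer ϖ) {t : RescaledCompletion F p v hv}
    (ht1 : (p : ℝ)⁻¹ * ‖(ϖ : RescaledCompletion F p v hv)‖ < ‖t‖) (ht2 : ‖t‖ ≤ ‖(ϖ : RescaledCompletion F p v hv)‖) :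
    ∃ g ∈ ismDH logv (.inr v),
      toR p v hv (g (ofR p v hv t)) = ϖ ∧
      (fun a => toR p v hv (g (ofR p v hv a))) '' closedBall (0 : RescaledCompletion F p v hv) ‖t‖ ⊆
          closedBall 0 ‖(ϖ : RescaledCompletion F p v hv)‖ ∧
      (ϖ : RescaledCompletion F p v hv) ∈
          (fun a => toR p v hv (g (ofR p v hv a))) '' closedBall (0 : RescaledCompletion F p v hv) ‖t‖ ∧
      ∀ tq : RescaledCompletion F p v hv, ‖tq‖ ≤ ‖(ϖ : RescaledCompletion F p v hv)‖ →
        ∀ μ : RescaledCompletion F p v hv,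
          (fun a => toR p v hv (g (ofR p v hv a))) '' closedBall (0 : RescaledCompletion F p v hv) ‖t‖ ⊆
              closedBall 0 ‖μ‖ →
            closedBall (0 : RescaledCompletion F p v hv) ‖tq‖ ⊆ closedBall 0 ‖μ‖ := by
  obtain ⟨g, hg, hgt, himg, htop, -, hhull⟩ :=
    exists_mem_ismDH_map_eq_zpow_smul_of_tame hlog hp2 he hϖ (t := t) 0 (by rwa [zpow_zero, one_mul])
      (by rwa [zpow_zero, one_mul])
  rw [zpow_zero, one_smul] at hgt htop
  rw [zpow_zero, inv_one, one_mul] at himg hhull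
  exact ⟨g, hg, hgt, himg, htop, fun tq htq μ hμ => (closedBall_subset_closedBall htq).trans (hhull μ hμ)⟩

include hlog in
/-- **Converse (upper bound, all of (Ind2))**: for `t` with `p^m·‖t‖ ≤ ‖ϖ‖` (content `≥ m`) EVERY
`g ∈ Real.ismDH logv (inr v)` keeps the box `t·𝒪_v` inside `p^m·𝔪_v = {‖y‖ ≤ p^{−m}·‖ϖ‖}` (it is a lattice
automorphism of `Λ = 𝔪_v`, w5-d180 `exists_mem_latticeAut_of_mem_ismDH`, hence fixes `p^m·Λ`). With the mover this makes
the one-factor hull of the (Ind2)-orbit of a content-`m` box EXACTLY `p^m·𝔪_v`: at one factor the licence «q-box inside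
the hull of some (Ind2)-image of the Θ-box» holds iff `ord_v(t_q) ≥ e·m + 1` (abc-iut-w4-d094's regime (B) condition,
two-sided here). [cite: DupuyHilado2025, §4.9] [cite: WeilBNT1967, Ch. II §2, Th. 1–2]
[claim: Mochizuki2012, status: disputed] -/
theorem forall_ismDH_image_closedBall_subset_of_tame (hp2 : 2 < p) (he : v.asIdeal.ramificationIdx ℤ ≤ p - 2)
    {ϖ : (RescaledCompletion F p v hv)ˣ} (hϖ : IsUniformizer ϖ) {t : RescaledCompletion F p v hv} (m : ℤ)
    (ht2 : (p : ℝ) ^ m * ‖t‖ ≤ ‖(ϖ : RescaledCompletion F p v hv)‖) :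
    ∀ g ∈ ismDH logv (.inr v),
      (fun a => toR p v hv (g (ofR p v hv a))) '' closedBall (0 : RescaledCompletion F p v hv) ‖t‖ ⊆
        closedBall 0 (((p : ℝ) ^ m)⁻¹ * ‖(ϖ : RescaledCompletion F p v hv)‖) := by
  intro g hg
  obtain ⟨n, hn, B, hΛ⟩ := exists_basis_coe_logUnits_eq (p := p) v hv
  have hball : (PadicModule.basisLattice p B : Set (RescaledCompletion F p v hv)) =
      closedBall 0 ‖(ϖ : RescaledCompletion F p v hv)‖ := by
    rw [← hΛ, logUnits_eq_closedBall_of_tame hp2 he hϖ]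
  obtain ⟨φ, hφ, hφg⟩ := exists_mem_latticeAut_of_mem_ismDH hlog B hΛ hg
  have hpm : (0 : ℝ) < (p : ℝ) ^ m := zpow_pos (by exact_mod_cast hp.out.pos) m
  have himg := PadicModule.image_smul_basisLattice_of_mem p B hφ ((p : ℚ_[p]) ^ m)
  rw [hball, smul_closedBall _ _ (norm_nonneg _), smul_zero, norm_padic_zpow_eq] at himg
  have htc : ‖t‖ ≤ ((p : ℝ) ^ m)⁻¹ * ‖(ϖ : RescaledCompletion F p v hv)‖ := by
    rw [le_inv_mul_iff₀ hpm]; exact ht2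
  rintro _ ⟨a, ha, rfl⟩
  have ha' : a ∈ closedBall (0 : RescaledCompletion F p v hv)
      (((p : ℝ) ^ m)⁻¹ * ‖(ϖ : RescaledCompletion F p v hv)‖) :=
    closedBall_subset_closedBall htc ha
  have h' : φ a ∈ (φ : RescaledCompletion F p v hv → RescaledCompletion F p v hv) ''
      closedBall (0 : RescaledCompletion F p v hv) (((p : ℝ) ^ m)⁻¹ * ‖(ϖ : RescaledCompletion F p v hv)‖) :=
    ⟨a, ha', rfl⟩
  rw [himg] at h'
  show toR p v hv (g (ofR p v hv a)) ∈ _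
  rw [← hφg]
  exact h'

end Summit.ABC.IUTFork.Thm311.Real

end
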